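import Summits.RiemannHypothesis.RiemannHypothesis.Theorems.Splittings.LinearRayCuspSeries

/-!
# Linear ray, cusp transformation III — the dual theta sums at `W₀ = K/2 + i/2`: head terms and geometric tails
(part 3 of 4) `‖G k W₀‖ ≤ 2e^{−πK/8}((π/4)^k + (4π)^k r_k/(1−r_k))` and `Re(e^{iπ/8} G 2 W₀) ≥ 2e^{−πK/8}((π/4)² − 16π² r₂/(1−r₂))`,
`r_k = e^{−(πK−2k)}` — the two head terms `n ∈ {0, −1}` are real positive after the phase `e^{iπ/8}`, everything else is
bounded in absolute value (no parity bookkeeping needed). `def`s are DATA (`hsq`, `W0`, `gk`, `c8`).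
HONEST LABEL: a refutation of an RH-STRENGTHENING conjunct (the linear-factor ray); RH-free; nothing here bears on the truth of RH.
Provenance: rh-splitx-eng-5 g2 (cell rh-split, D-0116 arm; C15 / S-dbn-1 filler → kernel), monolith HOME/rh-splitx-eng-5/dbn/LinearRayCusp.lean; references: C. G. J. Jacobi (imaginary transformation of ϑ), B. Riemann / E. C. Titchmarsh §10.1 (Φ and Ξ), N. G. de Bruijn, Duke Math. J. 17 (1950) (Φ as analytic kernel).

FILING DELTA (lead RULING #49, flag F1, lean/CONVENTIONS.md §2): outer namespace `Summit.RiemannHypothesis.RiemannHypothesis.Theorems.Splittings.LinearRayCusp` added — `CuspTransform` is nested inside it (namespace/`open` lines only; decl text unchanged).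
-/

noncomputable section

set_option linter.dupNamespace false

open Complex Real Set Filter Topology

namespace Summit.RiemannHypothesis.RiemannHypothesis.Theorems.Splittings.LinearRayCusp

namespace CuspTransform
/-! ## Stage D1: the dual sums at `W₀ = K/2 + i/2` — head terms and tails -/

/-- `h_n² = (n + ½)²`. -/
def hsq (n : ℤ) : ℝ := ((n : ℝ) + 1 / 2) ^ 2

/-- `W₀(K) = K/2 + i/2`. -/
def W0 (K : ℝ) : ℂ := ((K / 2 : ℝ) : ℂ) + ((1 / 2 : ℝ) : ℂ) * I

/-- `Re W₀(K) = K/2`. -/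
theorem W0_re (K : ℝ) : (W0 K).re = K / 2 := by simp [W0]

/-- the size of the `n`-th dual term: `g_k(n) = (π h_n²)^k e^{−π h_n² K/2} = ‖eterm h_n² k W₀‖`. -/
def gk (K : ℝ) (k : ℕ) (n : ℤ) : ℝ := (π * hsq n) ^ k * Real.exp (-(π * hsq n * (K / 2)))

/-- `g_k(n) ≥ 0`. -/
theorem gk_nonneg (K : ℝ) (k : ℕ) (n : ℤ) : 0 ≤ gk K k n := by
  unfold gk hsq; positivity

/-- `‖eterm h_n² k W₀‖ = g_k(n)`. -/
theorem norm_eterm_W0 (K : ℝ) (k : ℕ) (n : ℤ) : ‖eterm (hsq n) k (W0 K)‖ = gk K k n := by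
  rw [norm_eterm _ (by unfold hsq; positivity), W0_re]; rfl

/-- `Σ_n g_k(n)` converges for `K > 0`. -/
theorem summable_gk {K : ℝ} (hK : 0 < K) (k : ℕ) : Summable (gk K k) := by
  have := summable_G_majorant (δ := K / 2) (by linarith) k
  refine this.congr fun n => ?_
  simp only [gk, hsq]

/-- Symmetry `g_k(−(n+1)) = g_k(n)` (`h_{−n−1} = −h_n`). -/
theorem gk_neg (K : ℝ) (k : ℕ) (n : ℕ) : gk K k (-((n : ℤ) + 1)) = gk K k n := by
  simp only [gk, hsq, Int.cast_neg, Int.cast_add, Int.cast_natCast, Int.cast_one]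
  have : (-((n : ℝ) + 1) + 1 / 2) ^ 2 = ((n : ℝ) + 1 / 2) ^ 2 := by ring
  rw [this]

/-- The head term: `g_k(0) = (π/4)^k e^{−πK/8}`. -/
theorem gk_zero (K : ℝ) (k : ℕ) : gk K k 0 = (π / 4) ^ k * Real.exp (-(π * K / 8)) := by
  simp only [gk, hsq, Int.cast_zero, zero_add]
  congr 1
  · ring_nf
  · congr 1; ring

/-- `Σ_{n∈ℤ} g = 2 (g(0) + Σ_{n≥1} g(n))`. -/
theorem tsum_gk_eq {K : ℝ} (hK : 0 < K) (k : ℕ) :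
    ∑' n : ℤ, gk K k n = 2 * (gk K k 0 + ∑' n : ℕ, gk K k ((n : ℤ) + 1)) := by
  have hs := summable_gk hK k
  rw [← tsum_nat_add_neg_add_one hs]
  have hnat : Summable fun n : ℕ => gk K k (n : ℤ) := hs.comp_injective Nat.cast_injective
  have e : (fun n : ℕ => gk K k (n : ℤ) + gk K k (-((n : ℤ) + 1))) = fun n : ℕ => 2 * gk K k (n : ℤ) := by
    funext n; rw [gk_neg]; ring
  rw [e, tsum_mul_left, hnat.tsum_eq_zero_add]
  push_cast
  ring_nf

/-- termwise geometric domination of the tail: for `m = n+1 ≥ 1`,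
`g_k(m) ≤ (4π)^k e^{−πK/8} · (e^{−(πK − 2k)})^m`. -/
theorem gk_succ_le {K : ℝ} (hK : 0 < K) (k : ℕ) (n : ℕ) :
    gk K k ((n : ℤ) + 1) ≤ (4 * π) ^ k * Real.exp (-(π * K / 8)) * Real.exp (-(π * K - 2 * k)) ^ (n + 1) := by
  have hm : (1 : ℝ) ≤ (n : ℝ) + 1 := by have := Nat.cast_nonneg (α := ℝ) n; linarith
  set m : ℝ := (n : ℝ) + 1 with hmdef
  have hsq_eq : hsq ((n : ℤ) + 1) = (m + 1 / 2) ^ 2 := by simp [hsq, hmdef]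
  unfold gk
  rw [hsq_eq]
  -- polynomial factor: (π (m+1/2)²)^k ≤ (4π)^k e^{2k m}   [ (m+1/2)² ≤ 4 m² ≤ 4 e^{2m} ]
  have h1 : π * (m + 1 / 2) ^ 2 ≤ 4 * π * Real.exp (2 * m) := by
    have hm2 : (m + 1 / 2) ^ 2 ≤ 4 * m ^ 2 := by nlinarith
    have hexp : m ≤ Real.exp m := by linarith [Real.add_one_le_exp m]
    have hexp2 : m ^ 2 ≤ Real.exp (2 * m) := by
      rw [show (2 : ℝ) * m = m + m by ring, Real.exp_add, sq]
      exact mul_le_mul hexp hexp (by linarith) (Real.exp_pos _).le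
    nlinarith [Real.pi_pos, Real.exp_pos (2 * m)]
  have hp : (π * (m + 1 / 2) ^ 2) ^ k ≤ (4 * π) ^ k * Real.exp (2 * k * m) := by
    calc (π * (m + 1 / 2) ^ 2) ^ k ≤ (4 * π * Real.exp (2 * m)) ^ k :=
          pow_le_pow_left₀ (by positivity) h1 k
      _ = (4 * π) ^ k * Real.exp (2 * k * m) := by
          rw [mul_pow, ← Real.exp_nat_mul]; ring_nf
  -- exponential factor: e^{−π (m+1/2)² K/2} ≤ e^{−πK/8} e^{−π K m}   [ (m+1/2)² = m² + m + 1/4 ≥ 2m + 1/4 ]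
  have he : Real.exp (-(π * (m + 1 / 2) ^ 2 * (K / 2))) ≤ Real.exp (-(π * K / 8)) * Real.exp (-(π * K * m)) := by
    rw [← Real.exp_add]
    apply Real.exp_le_exp.2
    have : 2 * m + 1 / 4 ≤ (m + 1 / 2) ^ 2 := by nlinarith
    nlinarith [Real.pi_pos, mul_pos Real.pi_pos hK]
  calc (π * (m + 1 / 2) ^ 2) ^ k * Real.exp (-(π * (m + 1 / 2) ^ 2 * (K / 2)))
      ≤ ((4 * π) ^ k * Real.exp (2 * k * m)) * (Real.exp (-(π * K / 8)) * Real.exp (-(π * K * m))) :=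
        mul_le_mul hp he (Real.exp_pos _).le (by positivity)
    _ = (4 * π) ^ k * Real.exp (-(π * K / 8)) * Real.exp (-(π * K - 2 * k)) ^ (n + 1) := by
        rw [← Real.exp_nat_mul]
        have : (4 * π) ^ k * Real.exp (2 * k * m) * (Real.exp (-(π * K / 8)) * Real.exp (-(π * K * m))) =
            (4 * π) ^ k * Real.exp (-(π * K / 8)) * (Real.exp (2 * k * m) * Real.exp (-(π * K * m))) := by ring
        rw [this, ← Real.exp_add]
        congr 2
        push_cast
        rw [hmdef]; ring

/-- the geometric tail bound: `Σ_{n≥1} g_k(n) ≤ (4π)^k e^{−πK/8} · r/(1−r)`, `r = e^{−(πK−2k)} < 1`. -/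
theorem tsum_gk_tail_le {K : ℝ} (hK : 0 < K) (k : ℕ) (hKk : 2 * (k : ℝ) < π * K) :
    ∑' n : ℕ, gk K k ((n : ℤ) + 1) ≤
      (4 * π) ^ k * Real.exp (-(π * K / 8)) * (Real.exp (-(π * K - 2 * k)) / (1 - Real.exp (-(π * K - 2 * k)))) := by
  set r := Real.exp (-(π * K - 2 * k)) with hr
  have hr0 : 0 ≤ r := (Real.exp_pos _).le
  have hr1 : r < 1 := by rw [hr]; exact Real.exp_lt_one_iff.2 (by linarith)
  have hgeo : HasSum (fun n : ℕ => r ^ (n + 1)) (r / (1 - r)) := by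
    have h := (hasSum_geometric_of_lt_one hr0 hr1).mul_left r
    have e : (fun n : ℕ => r * r ^ n) = fun n : ℕ => r ^ (n + 1) := by funext n; ring
    rw [e] at h
    rwa [div_eq_mul_inv]
  have hsum_rhs : Summable fun n : ℕ => (4 * π) ^ k * Real.exp (-(π * K / 8)) * r ^ (n + 1) :=
    (hgeo.summable).mul_left _
  have hsum_lhs : Summable fun n : ℕ => gk K k ((n : ℤ) + 1) :=
    (summable_gk hK k).comp_injective (i := fun n : ℕ => (n : ℤ) + 1) (fun a b h => by simpa using h)
  calc ∑' n : ℕ, gk K k ((n : ℤ) + 1) ≤ ∑' n : ℕ, (4 * π) ^ k * Real.exp (-(π * K / 8)) * r ^ (n + 1) :=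
        Summable.tsum_le_tsum (fun n => gk_succ_le hK k n) hsum_lhs hsum_rhs
    _ = (4 * π) ^ k * Real.exp (-(π * K / 8)) * (r / (1 - r)) := by
        rw [tsum_mul_left, hgeo.tsum_eq]

/-- **Norm bound for the dual sums**: `‖G_k(W₀)‖ ≤ 2 e^{−πK/8} ((π/4)^k + (4π)^k r_k/(1−r_k))`. -/
theorem norm_G_W0_le {K : ℝ} (hK : 0 < K) (k : ℕ) (hKk : 2 * (k : ℝ) < π * K) :
    ‖G k (W0 K)‖ ≤ 2 * Real.exp (-(π * K / 8)) *
      ((π / 4) ^ k + (4 * π) ^ k * (Real.exp (-(π * K - 2 * k)) / (1 - Real.exp (-(π * K - 2 * k))))) := by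
  have hs := summable_gk hK k
  have h1 : ‖G k (W0 K)‖ ≤ ∑' n : ℤ, gk K k n := by
    unfold G
    have hn : Summable fun n : ℤ => ‖eterm (hsq n) k (W0 K)‖ := by simpa only [norm_eterm_W0] using hs
    calc ‖∑' n : ℤ, eterm (((n : ℝ) + 1 / 2) ^ 2) k (W0 K)‖ = ‖∑' n : ℤ, eterm (hsq n) k (W0 K)‖ := rfl
      _ ≤ ∑' n : ℤ, ‖eterm (hsq n) k (W0 K)‖ := norm_tsum_le_tsum_norm hn
      _ = ∑' n : ℤ, gk K k n := tsum_congr fun n => norm_eterm_W0 K k n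
  rw [tsum_gk_eq hK k, gk_zero] at h1
  have h2 := tsum_gk_tail_le hK k hKk
  nlinarith [h1, h2, Real.exp_pos (-(π * K / 8))]

/-- the phase `c = e^{iπ/8}`. -/
def c8 : ℂ := cexp (((π / 8 : ℝ) : ℂ) * I)

/-- `‖e^{iπ/8}‖ = 1`. -/
theorem norm_c8 : ‖c8‖ = 1 := by unfold c8; exact Complex.norm_exp_ofReal_mul_I _

/-- the two head terms are real and positive after the phase `e^{iπ/8}`:
`e^{iπ/8} · eterm(¼, k, W₀) = (−1)^k (π/4)^k e^{−πK/8}` — we need `k = 2`. -/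
theorem c8_mul_eterm_head (K : ℝ) :
    c8 * eterm (1 / 4) 2 (W0 K) = (((π / 4) ^ 2 * Real.exp (-(π * K / 8)) : ℝ) : ℂ) := by
  unfold c8 eterm W0
  have e : -(π : ℂ) * ((1 / 4 : ℝ) : ℂ) * ((((K / 2 : ℝ) : ℂ)) + ((1 / 2 : ℝ) : ℂ) * I) =
      ((-(π * K / 8) : ℝ) : ℂ) + ((-(π / 8) : ℝ) : ℂ) * I := by push_cast; ring
  rw [e, Complex.exp_add, ← Complex.ofReal_exp]
  rw [show cexp (((π / 8 : ℝ) : ℂ) * I) * ((-(π : ℂ) * ((1 / 4 : ℝ) : ℂ)) ^ 2 * ((Real.exp (-(π * K / 8)) : ℂ) *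
      cexp (((-(π / 8) : ℝ) : ℂ) * I))) = ((-(π : ℂ) * ((1 / 4 : ℝ) : ℂ)) ^ 2 * (Real.exp (-(π * K / 8)) : ℂ)) *
      (cexp (((π / 8 : ℝ) : ℂ) * I) * cexp (((-(π / 8) : ℝ) : ℂ) * I)) by ring]
  rw [← Complex.exp_add, show ((π / 8 : ℝ) : ℂ) * I + ((-(π / 8) : ℝ) : ℂ) * I = 0 by push_cast; ring,
    Complex.exp_zero, mul_one]
  push_cast; ring

/-- `h₀² = ¼`. -/
theorem hsq_zero : hsq 0 = 1 / 4 := by norm_num [hsq]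
/-- `h₋₁² = ¼`. -/
theorem hsq_neg_one : hsq (-1) = 1 / 4 := by norm_num [hsq]

/-- **Real-part lower bound for the top dual sum**:
`Re(e^{iπ/8} G₂(W₀)) ≥ 2 e^{−πK/8} ((π/4)² − (4π)² r₂/(1−r₂))`, `r₂ = e^{−(πK−4)}`. -/
theorem re_c8_mul_G_two_ge {K : ℝ} (hK : 0 < K) (hK4 : 2 * ((2 : ℕ) : ℝ) < π * K) :
    2 * Real.exp (-(π * K / 8)) * ((π / 4) ^ 2 - (4 * π) ^ 2 *
        (Real.exp (-(π * K - 2 * (2 : ℕ))) / (1 - Real.exp (-(π * K - 2 * (2 : ℕ)))))) ≤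
      (c8 * G 2 (W0 K)).re := by
  -- the series
  set f : ℤ → ℂ := fun n => c8 * eterm (hsq n) 2 (W0 K) with hf
  have hsumE : Summable fun n : ℤ => eterm (hsq n) 2 (W0 K) :=
    Summable.of_norm (by simpa only [norm_eterm_W0] using summable_gk hK 2)
  have hG : G 2 (W0 K) = ∑' n : ℤ, eterm (hsq n) 2 (W0 K) := rfl
  have h1 : c8 * G 2 (W0 K) = ∑' n : ℤ, f n := by rw [hG, ← tsum_mul_left]
  have hsf : Summable f := hsumE.mul_left c8
  have hre : (c8 * G 2 (W0 K)).re = ∑' n : ℤ, (f n).re := by rw [h1]; exact Complex.re_tsum hsf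
  -- termwise lower bound b n ≤ (f n).re
  set g : ℤ → ℝ := gk K 2 with hg
  have hgs : Summable g := summable_gk hK 2
  have hnormf : ∀ n, ‖f n‖ = g n := by
    intro n; rw [hf]; simp only [norm_mul, norm_c8, one_mul, norm_eterm_W0, hg]
  have head : ∀ n : ℤ, n = 0 ∨ n = -1 → (f n).re = g n := by
    intro n hn
    have hq : hsq n = 1 / 4 := by rcases hn with h | h <;> simp [h, hsq_zero, hsq_neg_one]
    have : f n = ((g n : ℝ) : ℂ) := by
      simp only [hf, hq, c8_mul_eterm_head, hg, gk]
      push_cast; ring_nf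
    rw [this, Complex.ofReal_re]
  set b : ℤ → ℝ := fun n => if n = 0 ∨ n = -1 then g n else -g n with hb
  have hb_le : ∀ n, b n ≤ (f n).re := by
    intro n; simp only [hb]
    split_ifs with h
    · exact (head n h).ge
    · have := Complex.abs_re_le_norm (f n); rw [hnormf] at this; exact (abs_le.1 this).1 |> fun h' => by linarith
  have hbs : Summable b := by
    refine Summable.of_norm_bounded hgs fun n => ?_
    simp only [hb]; split_ifs <;> simp [Real.norm_eq_abs, abs_of_nonneg (gk_nonneg K 2 n), hg]
  have hsre : Summable fun n => (f n).re := (Complex.hasSum_re hsf.hasSum).summable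
  have hmain : ∑' n, b n ≤ ∑' n, (f n).re := Summable.tsum_le_tsum hb_le hbs hsre
  -- evaluate Σ b = 2(g 0 + g (-1)) - Σ g = 4 g 0 - Σ g
  have hb_eq : b = fun n => (if n = 0 ∨ n = -1 then 2 * g n else 0) + -g n := by
    funext n; simp only [hb]; split_ifs <;> ring
  have hfinHS : HasSum (fun n : ℤ => if n = 0 ∨ n = -1 then 2 * g n else 0)
      (∑ n ∈ ({0, -1} : Finset ℤ), if n = 0 ∨ n = -1 then 2 * g n else 0) := by
    refine hasSum_sum_of_ne_finset_zero fun n hn => ?_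
    simp only [Finset.mem_insert, Finset.mem_singleton, not_or] at hn
    simp [hn.1, hn.2]
  have hfin : ∑' n : ℤ, (if n = 0 ∨ n = -1 then 2 * g n else 0) = 2 * g 0 + 2 * g (-1) := by
    rw [hfinHS.tsum_eq]; simp
  have hsumb : ∑' n, b n = (2 * g 0 + 2 * g (-1)) - ∑' n, g n := by
    rw [hb_eq, hfinHS.summable.tsum_add hgs.neg, tsum_neg, hfin]; ring
  have hgm1 : g (-1) = g 0 := by
    simp only [hg, gk, hsq_zero, hsq_neg_one]
  have htot := tsum_gk_eq hK 2
  have htail := tsum_gk_tail_le hK 2 hK4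
  rw [hre]
  refine le_trans ?_ hmain
  rw [hsumb, hgm1, hg, htot, gk_zero]
  have hE := Real.exp_pos (-(π * K / 8))
  nlinarith [htail, hE]

end CuspTransform

end Summit.RiemannHypothesis.RiemannHypothesis.Theorems.Splittings.LinearRayCusp

end
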